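import Literature.AnabelianGeometry.EtaleTheta.ThetaCohomology
import Literature.AnabelianGeometry.EtaleTheta.TemperedRigidity
import Literature.AnabelianGeometry.EtaleTheta.ContH1ConjAction
import HarnessLib

/-!
# [EtTh] §1: Def. 1.7, Prop. 1.8, Def. 1.9, Rmk. 1.9.1, Thm. 1.10 — curves of type `(1, μ₂)` and the
# constant multiple rigidity of the étale theta function

Mochizuki, *The étale theta function …*, Publ. RIMS **45** (2009), §1, PRIMS PDF pp. 27–33 (printed
253–259) [cite: MochizukiEtTh2009, Thm 1.10 p.29]. Layer L2 of the abc-iut cell, seat abc-iut-L2-t1;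
plan/FOUNDATIONS.md row 40 (Thm. 1.10 = FACT of this layer: typed, not proved). Typed over
`ThetaSetting` / `EtaleThetaData` / `NonCuspidalPoint` and the concrete `H¹`.

**Setting of pp. 27 (Def. 1.7).** Under "(I) `K = K̈`" and "(II) the hyperbolic curve determined by
`X^log` is not arithmetic over `K`" one has the degree-4 Galois covering `Ẍ^log → X^log` (multiplication
by 2), the stack quotient `X^log → C^log` by `±1`, `Gal(Ẍ/C) ≅ (ℤ/2ℤ)³`, the elements `ε_μ ∈ Gal(Ẍ/X)`,
`ε_± ∈ Gal(Ẍ/C)`, and for a choice of `ε_Z ∈ Gal(Ẍ/X) ∖ {1, ε_μ}` the curves `Ẋ := Ẍ/⟨ε_Z⟩`,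
`Ċ := Ẋ/⟨ε_± ε_μ⟩`. All of this is GROUP THEORY inside `Π^tp_C ⊇ Π^tp_X`: `MuTwoSetting` carries
`Π^tp_C` (`GtpC`), the inclusion `Π^tp_X ↪ Π^tp_C` of index 2, `Π^tp_Ẍ ≤ Π^tp_X`, and representatives
`ε_μ, ε_±`; `Π^tp_Ẋ`, `Π^tp_Ċ` are DEFINED (`dotX`, `dotC`). Condition (II) has no carrier (it asserts
that `C` is a `K`-core, [CanLift] = [Mzk3] Rmk. 2.1.1) and is recorded in docstrings only; the
characterisations "unique nontrivial element acting trivially on the irreducible components / on the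
cusps" of `ε_μ`, `ε_±` likewise (no carrier for components/cusps of `Ẍ`).

**Limits of the typing (vacuity note).** "Of type `(1, μ₂)`" is a property of a CURVE; here it is a
property of a subgroup of a GIVEN `Π^tp_C` (`MuTwoSetting.IsOfTypeOneMuTwo`), since quantifying
existentially over models of the interface would be vacuous. Thm. 1.10 (iii) (the `{±1}`-structure on
the `(K^×)^∧`-torsor at the cusp of `Ċ`, [GalSect] = [Mzk13] Cor. 4.12) is NOT typed — its vocabulary
(torsors at cusps, canonical integral structure) belongs to layer L4; Remarks 1.10.1–1.10.4 are
commentary/erratum (doc paragraphs at the end); the `ε_μ, ε_± ↦ −η̈^{Θ,Z}` clause of Rmk. 1.9.1 is not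
typed (our `H¹` action is by `Π^tp_X`, not by `Π^tp_C ∖ Π^tp_X`). HONEST FRAMING: typed ≠ proved.
-/

noncomputable section

namespace Literature.AnabelianGeometry.EtaleTheta

open Literature.AnabelianGeometry.SemiGraphs

variable {p : ℕ} [Fact p.Prime]

/-! ### The setting of Definition 1.7 -/

/-- **The setting of Def. 1.7** (p. 27): a §1 theta setting satisfying "(I) `K = K̈`" together with
`Π^tp_C` of "the stack-theoretic quotient `X^log → C^log` of `X^log` by the natural action of `±1`",
`Π^tp_Ẍ` of "the Galois covering `Ẍ^log → X^log` of degree 4 determined by the multiplication by 2 map"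
("the covering `Ẍ^log → C^log` is Galois, with Galois group isomorphic to `(ℤ/2ℤ)³`"), and
representatives of "`ε_μ ∈ Gal(Ẍ/X)` … the unique nontrivial element of `Gal(Ẍ/X)` that acts trivially
on the set of irreducible components of the special fiber; `ε_± ∈ Gal(Ẍ/C)` the unique nontrivial
element of `Gal(Ẍ/C)` that acts trivially on the set of cusps of `Ẍ`" (characterisations not typed).
Condition "(II) not arithmetic over `K`" (p. 27) is assumed in print and has no carrier here.
[cite: MochizukiEtTh2009, Def 1.7 p.27] -/
structure MuTwoSetting (p : ℕ) [Fact p.Prime] extends ThetaSetting p where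
  /-- (I) `K = K̈` (p. 27): `q_X^{1/2} ∈ K`, so that `K̈ = K(ζ₂, q_X^{1/2}) = K`. -/
  sqrtqX_mem_K : sqrtqX ∈ K
  /-- `Π^tp_C`, the tempered fundamental group of the orbicurve `C^log = X^log/±1` (p. 27). -/
  GtpC : Type
  [instGroupGtpC : Group GtpC]
  [instTopGtpC : TopologicalSpace GtpC]
  [instTopGroupGtpC : IsTopologicalGroup GtpC]
  /-- `Π^tp_X ↪ Π^tp_C` (`X^log → C^log`, p. 27). -/
  inclX : PiTemp →* GtpC
  /-- `Π^tp_X ↪ Π^tp_C` is continuous … -/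
  continuous_inclX : Continuous inclX
  /-- … injective … -/
  injective_inclX : Function.Injective inclX
  /-- … with open image … -/
  isOpen_range_inclX : IsOpen (inclX.range : Set GtpC)
  /-- … normal (quotient by a group action) … -/
  range_inclX_normal : inclX.range.Normal
  /-- … of index 2 ("quotient … by the natural action of `±1`", p. 27). -/
  index_range_inclX : inclX.range.index = 2
  /-- `Π^tp_Ẍ ≤ Π^tp_X`: "the Galois covering of degree 4 determined by the multiplication by 2 map on
  the elliptic curve underlying `X`" (p. 27). -/
  GtpXdd : Subgroup PiTemp
  /-- `Ẍ → X` has degree 4. -/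
  index_GtpXdd : GtpXdd.index = 4
  /-- "`Ẍ^log → C^log` is Galois": `Π^tp_Ẍ` is normal in `Π^tp_C` … -/
  map_GtpXdd_normal : (GtpXdd.map inclX).Normal
  /-- … "with Galois group isomorphic to `(ℤ/2ℤ)³`": every square lies in `Π^tp_Ẍ` (the index is
  `4 · 2 = 8` by the two index fields). -/
  sq_mem_GtpXdd : ∀ g : GtpC, g * g ∈ GtpXdd.map inclX
  /-- `Ÿ^log → Ẍ^log` (the natural morphism of the diagram on p. 27): `Π^tp_Ÿ ≤ Π^tp_Ẍ`. -/
  GtpYdd_le_GtpXdd : toThetaSetting.GtpYdd ≤ GtpXdd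
  /-- A representative in `Π^tp_X ⊆ Π^tp_C` of `ε_μ ∈ Gal(Ẍ/X)` (p. 27). -/
  epsMu : GtpC
  /-- `ε_μ ∈ Gal(Ẍ/X)`: the representative lies in `Π^tp_X` … -/
  epsMu_mem : epsMu ∈ inclX.range
  /-- … and `ε_μ` is nontrivial. -/
  epsMu_not_mem : epsMu ∉ GtpXdd.map inclX
  /-- A representative of `ε_± ∈ Gal(Ẍ/C)` (p. 27). -/
  epsPM : GtpC
  /-- `ε_±` does not lie over `X` (it lifts `−1`): the representative is not in `Π^tp_X`. -/
  epsPM_not_mem : epsPM ∉ inclX.range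

attribute [instance] MuTwoSetting.instGroupGtpC MuTwoSetting.instTopGtpC MuTwoSetting.instTopGroupGtpC

namespace MuTwoSetting

variable (M : MuTwoSetting p)

/-- An admissible choice of `ε_Z`: "a nontrivial element `ε_Z ∈ Gal(Ẍ/X)` which is `≠ ε_μ`" (p. 27),
through a representative in `Π^tp_C`. [cite: MochizukiEtTh2009, Def 1.7 p.27] -/
def IsAdmissibleEpsZ (εZ : M.GtpC) : Prop :=
  εZ ∈ M.inclX.range ∧ εZ ∉ M.GtpXdd.map M.inclX ∧ εZ * M.epsMu⁻¹ ∉ M.GtpXdd.map M.inclX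

/-- `Π^tp_Ẋ ≤ Π^tp_C` for "`Ẍ^log → Ẋ^log` … the quotient by the action of `ε_Z`" (p. 27).
[cite: MochizukiEtTh2009, Def 1.7 p.27] -/
def dotX (εZ : M.GtpC) : Subgroup M.GtpC := M.GtpXdd.map M.inclX ⊔ Subgroup.zpowers εZ

/-- `Π^tp_Ċ ≤ Π^tp_C` for "`Ẋ^log → Ċ^log` … the [stack-theoretic] quotient by the action of `ε_± · ε_μ`"
(p. 27). [cite: MochizukiEtTh2009, Def 1.7 p.27] -/
def dotC (εZ : M.GtpC) : Subgroup M.GtpC := M.dotX εZ ⊔ Subgroup.zpowers (M.epsPM * M.epsMu)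

/-- **Def. 1.7, type `(1, μ₂)`** (p. 27): "a smooth log orbicurve over `K` that arises, up to
isomorphism, as the smooth log orbicurve `Ẋ^log` … constructed above for some choice of `ε_Z`" — here,
relative to the given `Π^tp_C`: a subgroup of the form `Π^tp_Ẋ` for an admissible `ε_Z` (see the module
docstring for why the curve-level "up to isomorphism" is not quantified over interface models).
[cite: MochizukiEtTh2009, Def 1.7 p.27] -/
def IsOfTypeOneMuTwo (H : Subgroup M.GtpC) : Prop :=
  ∃ εZ, M.IsAdmissibleEpsZ εZ ∧ H = M.dotX εZ

/-- **Def. 1.7, type `(1, μ₂)±`** (p. 27): "… (respectively, `Ċ^log`) … as being of type `(1, μ₂)±`".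
[cite: MochizukiEtTh2009, Def 1.7 p.27] -/
def IsOfTypeOneMuTwoPM (H : Subgroup M.GtpC) : Prop :=
  ∃ εZ, M.IsAdmissibleEpsZ εZ ∧ H = M.dotC εZ

end MuTwoSetting

/-! ### Proposition 1.8 (Characteristic Nature of Coverings) -/

section Prop18

variable {Mα Mβ : MuTwoSetting p}

/-- The conclusion of Prop. 1.8 for an isomorphism `Γ : Π^tp_{Cα} →̃ Π^tp_{Cβ}`: it "induces an
isomorphism between the commutative diagrams of outer homomorphisms of topological groups
`Π^tp_{Ÿ☐} → Π^tp_{Ẍ☐} → Π^tp_{Ẋ☐} → Π^tp_{X☐}`, `Π^tp_{Ċ☐} → Π^tp_{C☐}` — where `☐ = α, β`" (p. 28), i.e.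
carries each subgroup of `α` onto the corresponding one of `β`. [cite: MochizukiEtTh2009, Prop 1.8 p.28] -/
structure PreservesCoverings (εα : Mα.GtpC) (εβ : Mβ.GtpC) (Γ : Mα.GtpC ≃ₜ* Mβ.GtpC) : Prop where
  /-- `Γ(Π^tp_{Ÿα}) = Π^tp_{Ÿβ}` -/
  map_Ydd : (Mα.GtpYdd.map Mα.inclX).map Γ.toMulEquiv.toMonoidHom = Mβ.GtpYdd.map Mβ.inclX
  /-- `Γ(Π^tp_{Ẍα}) = Π^tp_{Ẍβ}` -/
  map_Xdd : (Mα.GtpXdd.map Mα.inclX).map Γ.toMulEquiv.toMonoidHom = Mβ.GtpXdd.map Mβ.inclX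
  /-- `Γ(Π^tp_{Ẋα}) = Π^tp_{Ẋβ}` -/
  map_dotX : (Mα.dotX εα).map Γ.toMulEquiv.toMonoidHom = Mβ.dotX εβ
  /-- `Γ(Π^tp_{Xα}) = Π^tp_{Xβ}` -/
  map_X : Mα.inclX.range.map Γ.toMulEquiv.toMonoidHom = Mβ.inclX.range
  /-- `Γ(Π^tp_{Ċα}) = Π^tp_{Ċβ}` -/
  map_dotC : (Mα.dotC εα).map Γ.toMulEquiv.toMonoidHom = Mβ.dotC εβ

/-- **Prop. 1.8 (Characteristic Nature of Coverings)**, the `Ẋ`-case (p. 28): for `Ẋ^log_☐` of type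
`(1, μ₂)`, "any isomorphism of topological groups `γ : Π^tp_{Ẋα} →̃ Π^tp_{Ẋβ}` … induces an isomorphism
between the commutative diagrams of outer homomorphisms …": `γ` extends, up to an inner automorphism of
`Π^tp_{Cβ}`, to `Γ : Π^tp_{Cα} →̃ Π^tp_{Cβ}` preserving all the coverings. The standing condition "(II)
`X^log` not arithmetic over `K`" (p. 27; `C` is a `K`-core — used in the printed proof via [SemiAnbd]
Thm. 6.8 (ii)) has no carrier in the tree and is NOT among the hypotheses here (disclosed, not
modelled). ("A similar statement holds when `Π^tp` is replaced by `Π`": not typed, no profinite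
`C`-data.) [cite: MochizukiEtTh2009, Prop 1.8 p.28] -/
def Prop18 {εα : Mα.GtpC} {εβ : Mβ.GtpC} (_hα : Mα.IsAdmissibleEpsZ εα)
    (_hβ : Mβ.IsAdmissibleEpsZ εβ) (γ : Mα.dotX εα ≃ₜ* Mβ.dotX εβ) : Prop :=
  ∃ Γ : Mα.GtpC ≃ₜ* Mβ.GtpC, PreservesCoverings εα εβ Γ ∧
    ∃ c : Mβ.GtpC, ∀ x : Mα.dotX εα, Γ.toMulEquiv x.1 = c * (γ.toMulEquiv x).1 * c⁻¹

/-- **Prop. 1.8**, the `Ċ`-case (p. 28): "(respectively, `γ : Π^tp_{Ċα} →̃ Π^tp_{Ċβ}`)".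
[cite: MochizukiEtTh2009, Prop 1.8 p.28] -/
def Prop18pm {εα : Mα.GtpC} {εβ : Mβ.GtpC} (_hα : Mα.IsAdmissibleEpsZ εα)
    (_hβ : Mβ.IsAdmissibleEpsZ εβ) (γ : Mα.dotC εα ≃ₜ* Mβ.dotC εβ) : Prop :=
  ∃ Γ : Mα.GtpC ≃ₜ* Mβ.GtpC, PreservesCoverings εα εβ Γ ∧
    ∃ c : Mβ.GtpC, ∀ x : Mα.dotC εα, Γ.toMulEquiv x.1 = c * (γ.toMulEquiv x).1 * c⁻¹

end Prop18

/-! ### Definition 1.9 and Remark 1.9.1 -/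

namespace MuTwoSetting

variable (M : MuTwoSetting p)

/-- The `Π^tp_Ẋ/Π^tp_Ÿ ≅ Z`-**orbit** of a class `x ∈ H¹(Π^tp_Ÿ, Δ_Θ)`: "write `η̈^{Θ,Z}` for the
`Π^tp_Ẋ/Π^tp_Ÿ ≅ Z`-orbit of `η̈^Θ`" (p. 29) — conjugates by elements of `Π^tp_X` lying in `Π^tp_Ẋ`.
[cite: MochizukiEtTh2009, Def 1.9 p.29] -/
def thetaOrbit (hC : M.toThetaSetting.Compat) (εZ : M.GtpC)
    (x : M.toThetaSetting.H1 M.toThetaSetting.GtpYdd) :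
    Set (M.toThetaSetting.H1 M.toThetaSetting.GtpYdd) :=
  haveI := hC.GtpYdd_normal
  {y | ∃ σ : M.PiTemp, M.inclX σ ∈ M.dotX εZ ∧
    y = ContH1.conj M.toTheta M.toThetaSetting.DeltaTheta σ x}

/-- **The data of Def. 1.9** (p. 29): "suppose that `√−1 ∈ K`" — a square root of `−1` — and the two
points "`√−1` determines a 4-torsion point `τ` of [the underlying elliptic curve of] `Ẋ` whose restriction
to the special fiber lies in the interior of the unique irreducible component …; the 4-torsion point
`τ⁻¹` determined by `−√−1` admits a similar description", as non-cuspidal points of `Ÿ` (through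
`NonCuspidalPoint`) with coordinates `Ü(τ) = √−1`, `Ü(τ⁻¹) = (√−1)⁻¹` (the value "at `√−1` of the series
representation of `Θ̈`", Def. 1.9 (ii)). [cite: MochizukiEtTh2009, Def 1.9 p.29] -/
structure StandardData (E : M.toThetaSetting.KummerData) where
  /-- `√−1 ∈ K = K̈` (p. 29), as an element of `ℚ̄_p` … -/
  sqrtNegOne : PadicAlgCl p
  /-- … lying in `K` … -/
  sqrtNegOne_mem : sqrtNegOne ∈ M.K
  /-- … with `(√−1)² = −1`. -/
  sqrtNegOne_sq : sqrtNegOne ^ 2 = -1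
  /-- the point `τ` of `Ÿ` over the 4-torsion point determined by `√−1` -/
  tau : ThetaSetting.NonCuspidalPoint E
  /-- the point `τ⁻¹` determined by `−√−1` -/
  tauInv : ThetaSetting.NonCuspidalPoint E
  /-- `Ü(τ) = √−1` -/
  tau_coord : ((tau.coord : M.Kdd) : PadicAlgCl p) = sqrtNegOne
  /-- `Ü(τ⁻¹) = (√−1)⁻¹ = −√−1` -/
  tauInv_coord : ((tauInv.coord : M.Kdd) : PadicAlgCl p) = sqrtNegOne⁻¹

variable {M}

/-- The set of values at a point `y₀` of the classes in the orbit `η̈^{Θ,Z}` ("[cf. Proposition 1.4,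
(iii)]", p. 29): the `v ∈ K^×` with `η|_{y₀} = v` for some `η ∈ η̈^{Θ,Z}`. [cite: MochizukiEtTh2009, Def 1.9 (i) p.29] -/
def valuesAt {E : M.toThetaSetting.KummerData} (hC : M.toThetaSetting.Compat) (εZ : M.GtpC)
    (x : M.toThetaSetting.H1 M.toThetaSetting.GtpYdd) (y₀ : ThetaSetting.NonCuspidalPoint E) :
    Set (↥M.Kdd)ˣ :=
  {v | ∃ y ∈ M.thetaOrbit hC εZ x,
    y₀.evalAt (ContH1.res M.toTheta M.toThetaSetting.DeltaTheta y₀.Dpt_le y) = E.toKddHat v}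

/-- **Def. 1.9 (i)** (p. 29): "We shall refer to either of the following two sets of values of
`η̈^{Θ,Z}`, `η̈^{Θ,Z}|_τ, η̈^{Θ,Z}|_{τ⁻¹} ⊆ K^×`, as a standard set of values of `η̈^{Θ,Z}`."
[cite: MochizukiEtTh2009, Def 1.9 (i) p.29] -/
def IsStandardSetOfValues {E : M.toThetaSetting.KummerData} (hC : M.toThetaSetting.Compat)
    (εZ : M.GtpC) (S : M.StandardData E) (x : M.toThetaSetting.H1 M.toThetaSetting.GtpYdd)
    (V : Set (↥M.Kdd)ˣ) : Prop :=
  V = valuesAt hC εZ x S.tau ∨ V = valuesAt hC εZ x S.tauInv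

/-- **Def. 1.9 (ii)** (p. 29): "If `η̈^{Θ,Z}` satisfies the property that the unique value `∈ O^×_K` … of
maximal order [i.e., relative to the valuation on `K`] of some standard set of values of `η̈^{Θ,Z}` is
equal to `±1`, then we shall say that `η̈^{Θ,Z}` is of standard type" — typed: some standard set of
values has an element of maximal order (minimal absolute value) which is a unit equal to `±1`.
[cite: MochizukiEtTh2009, Def 1.9 (ii) p.29] -/
def IsOfStandardType {E : M.toThetaSetting.KummerData} (hC : M.toThetaSetting.Compat) (εZ : M.GtpC)
    (S : M.StandardData E) (x : M.toThetaSetting.H1 M.toThetaSetting.GtpYdd) : Prop :=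
  ∃ V, IsStandardSetOfValues hC εZ S x V ∧ ∃ v ∈ V,
    (∀ w ∈ V, ‖((v : M.Kdd) : PadicAlgCl p)‖ ≤ ‖((w : M.Kdd) : PadicAlgCl p)‖) ∧
    v ∈ M.toThetaSetting.unitsOKdd ∧
    (((v : M.Kdd) : PadicAlgCl p) = 1 ∨ ((v : M.Kdd) : PadicAlgCl p) = -1)

/-- **Rmk. 1.9.1** (p. 29), first clause — PROVED ("immediate from the definitions", as printed): "any
inner automorphism of `Π^tp_Ċ` arising from `Π^tp_Ẋ` acts trivially on `η̈^{Θ,Z}`" — conjugation by an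
element of `Π^tp_X ∩ Π^tp_Ẋ` maps the orbit `η̈^{Θ,Z}` (of ANY class, for any `ε_Z`) onto itself; an
instance of the tree's `ContH1.image_conj_orbit_eq` for the subgroup `inclX⁻¹(Π^tp_Ẋ)`. (Second clause,
"`ε_μ, ε_±` map `η̈^{Θ,Z} ↦ −η̈^{Θ,Z}`", not typed: see the module docstring.)
[cite: MochizukiEtTh2009, Rmk 1.9.1 p.29] -/
theorem rmk191_conj_image_thetaOrbit (hC : M.toThetaSetting.Compat) (εZ : M.GtpC)
    (x : M.toThetaSetting.H1 M.toThetaSetting.GtpYdd) {σ : M.PiTemp} (hσ : M.inclX σ ∈ M.dotX εZ) :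
    (haveI := hC.GtpYdd_normal
     ContH1.conj M.toTheta M.toThetaSetting.DeltaTheta σ '' M.thetaOrbit hC εZ x =
      M.thetaOrbit hC εZ x) := by
  haveI := hC.GtpYdd_normal
  have key := ContH1.image_conj_orbit_eq ((M.dotX εZ).comap M.inclX) (Subgroup.mem_comap.mpr hσ) x
  simpa [MuTwoSetting.thetaOrbit, Subgroup.mem_comap] using key

end MuTwoSetting

/-! ### Theorem 1.10 (Constant Multiple Rigidity of the Étale Theta Function) -/

section Thm110

variable {Mα Mβ : MuTwoSetting p}

/-- **The hypothesis of Thm. 1.10** (pp. 29–30): `Ċ^log_☐` of type `(1, μ₂)±` over `K_☐ ∋ √−1`,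
"`γ : Π^tp_{Ċα} →̃ Π^tp_{Ċβ}` an isomorphism of topological groups", and "suppose that the isomorphism
`Π^tp_{Xα} →̃ Π^tp_{Xβ}` induced by `γ` [cf. Proposition 1.8] maps `η̈^{Θ,Z}_α ↦ η̈^{Θ,Z}_β` [cf. Theorem
1.6, (iii)]" — packaged: admissibility of `ε_{Z,☐}` (Def. 1.7: `Ċ_☐` IS of type `(1, μ₂)±`), the
extension `Γ` of Prop. 1.8, its restriction `γX` to `Π^tp_X` with a theta companion, and the
orbit-to-orbit condition via cocycle transport. As for Prop. 1.8, the standing condition "(II) not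
arithmetic over `K`" (p. 27) has no carrier and is not modelled. [cite: MochizukiEtTh2009, Thm 1.10 p.29] -/
structure Thm110Hypothesis (εα : Mα.GtpC) (εβ : Mβ.GtpC)
    (hCα : Mα.toThetaSetting.Compat) (hCβ : Mβ.toThetaSetting.Compat)
    (Eα : Mα.toThetaSetting.EtaleThetaData) (Eβ : Mβ.toThetaSetting.EtaleThetaData)
    (γ : Mα.dotC εα ≃ₜ* Mβ.dotC εβ) where
  /-- "`Ċ^log_α` … of type `(1, μ₂)±`": `ε_{Z,α} ∈ Gal(Ẍ_α/X_α)` is nontrivial and `≠ ε_μ` (Def. 1.7) -/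
  admα : Mα.IsAdmissibleEpsZ εα
  /-- "`Ċ^log_β` … of type `(1, μ₂)±`": `ε_{Z,β}` is admissible (Def. 1.7) -/
  admβ : Mβ.IsAdmissibleEpsZ εβ
  /-- the extension of `γ` to `Π^tp_C` (Prop. 1.8) -/
  Γ : Mα.GtpC ≃ₜ* Mβ.GtpC
  /-- `Γ` preserves the coverings -/
  preserves : PreservesCoverings εα εβ Γ
  /-- `Γ` restricts to `γ` up to an inner automorphism -/
  restricts : ∃ c : Mβ.GtpC, ∀ x : Mα.dotC εα, Γ.toMulEquiv x.1 = c * (γ.toMulEquiv x).1 * c⁻¹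
  /-- "the isomorphism `Π^tp_{Xα} →̃ Π^tp_{Xβ}` induced by `γ`" -/
  γX : Mα.PiTemp ≃ₜ* Mβ.PiTemp
  /-- `γX` is the restriction of `Γ` along `Π^tp_X ↪ Π^tp_C` -/
  γX_spec : ∀ x : Mα.PiTemp, Mβ.inclX (γX.toMulEquiv x) = Γ.toMulEquiv (Mα.inclX x)
  /-- `γX` satisfies Thm. 1.6 (i) -/
  thm16i : ThetaSetting.Thm16i γX
  /-- a theta companion of `γX` (Thm. 1.6 (ii)) -/
  companion : ThetaSetting.ThetaCompanion γX
  /-- the induced map carries `η̈^{Θ,Z}_α` onto `η̈^{Θ,Z}_β` -/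
  maps_orbit : ∀ y, y ∈ Mβ.thetaOrbit hCβ εβ Eβ.etaDd ↔
    ∃ x ∈ Mα.thetaOrbit hCα εα Eα.etaDd, y = ThetaSetting.transport companion thm16i x

variable {εα : Mα.GtpC} {εβ : Mβ.GtpC} {hCα : Mα.toThetaSetting.Compat}
  {hCβ : Mβ.toThetaSetting.Compat} {Eα : Mα.toThetaSetting.EtaleThetaData}
  {Eβ : Mβ.toThetaSetting.EtaleThetaData} {γ : Mα.dotC εα ≃ₜ* Mβ.dotC εβ}

/-- **Thm. 1.10 (i)** (p. 29): "The isomorphism `γ` preserves the property that `η̈^{Θ,Z}_☐` be of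
standard type". [cite: MochizukiEtTh2009, Thm 1.10 (i) p.29] -/
def Thm110i (_H : Thm110Hypothesis εα εβ hCα hCβ Eα Eβ γ)
    (Sα : Mα.StandardData Eα.toKummerData) (Sβ : Mβ.StandardData Eβ.toKummerData) : Prop :=
  Mα.IsOfStandardType hCα εα Sα Eα.etaDd ↔ Mβ.IsOfStandardType hCβ εβ Sβ Eβ.etaDd

/-- **Thm. 1.10 (i), second clause** (p. 29): standard type is "a property that determines this
collection of classes up to multiplication by `±1`" — for `Ẋ = Ẍ/⟨ε_Z⟩` of type `(1, μ₂)` (`ε_Z`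
admissible, Def. 1.7), within the `O^×_K`-torsor of étale theta classes: if both `η̈^{Θ,Z}` and
`(u · η̈)^{Θ,Z}`, `u ∈ O^×_K`, are of standard type, then `u = ±1`. [cite: MochizukiEtTh2009, Thm 1.10 (i) p.29] -/
def Thm110iUnique {M : MuTwoSetting p} (hC : M.toThetaSetting.Compat) {εZ : M.GtpC}
    (_hZ : M.IsAdmissibleEpsZ εZ) (E : M.toThetaSetting.EtaleThetaData)
    (S : M.StandardData E.toKummerData) : Prop :=
  ∀ u : (↥M.Kdd)ˣ, u ∈ M.toThetaSetting.unitsOKdd →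
    M.IsOfStandardType hC εZ S E.etaDd →
    M.IsOfStandardType hC εZ S
      (M.toThetaSetting.inflTheta M.toThetaSetting.GtpYdd (E.kumYdd (E.toKddHat u)) * E.etaDd) →
    ((u : M.Kdd) : PadicAlgCl p) = 1 ∨ ((u : M.Kdd) : PadicAlgCl p) = -1

/-- **Thm. 1.10 (ii)** (pp. 29–30): "The isomorphism `K^×_α →̃ K^×_β` — where we regard
`K^×_☐ ⊆ (K^×_☐)^∧ … ≅ H¹(G_{K☐}, (Δ_Θ)☐) ⊆ H¹(Π^tp_{Ċ☐}, (Δ_Θ)☐)` — induced by [an arbitrary] `γ` preserves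
the standard sets of values of `η̈^{Θ,Z}_☐`." Typed: there is `δ : K̈^×_α ≃ K̈^×_β` which IS induced by
`γ` on Kummer classes (cocycle transport along `γX` and its companion) and maps each standard set of
values of `α` to a standard set of values of `β`. [cite: MochizukiEtTh2009, Thm 1.10 (ii) p.30] -/
def Thm110ii (H : Thm110Hypothesis εα εβ hCα hCβ Eα Eβ γ)
    (Sα : Mα.StandardData Eα.toKummerData) (Sβ : Mβ.StandardData Eβ.toKummerData) : Prop :=
  ∃ δ : (↥Mα.Kdd)ˣ ≃* (↥Mβ.Kdd)ˣ,
    (∀ a : (↥Mα.Kdd)ˣ,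
      ThetaSetting.transport H.companion H.thm16i
          (Mα.toThetaSetting.inflTheta Mα.toThetaSetting.GtpYdd (Eα.kumYdd (Eα.toKddHat a))) =
        Mβ.toThetaSetting.inflTheta Mβ.toThetaSetting.GtpYdd (Eβ.kumYdd (Eβ.toKddHat (δ a)))) ∧
    ∀ V, Mα.IsStandardSetOfValues hCα εα Sα Eα.etaDd V →
      Mβ.IsStandardSetOfValues hCβ εβ Sβ Eβ.etaDd (δ '' V)

/-! **Thm. 1.10 (iii)** (p. 30): "Suppose that `η̈^{Θ,Z}_☐` is of standard type, and that the residue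
characteristic of `K_☐` is odd. Then `η̈^{Θ,Z}_☐` determines a `{±1}`-structure [cf. [GalSect], Corollary
4.12; Remark 1.10.1, (ii)] on the `(K^×_☐)^∧`-torsor at the unique cusp of `Ċ^log_☐` that is compatible
with the canonical integral structure and, moreover, preserved by [arbitrary] `γ`." NOT typed (deferred):
torsors at cusps, `{±1}`-structures and the canonical integral structure are [GalSect] §4 vocabulary
(layer L4); the hypothesis "residue characteristic odd" would read
`Odd p`.

**Remark 1.10.1** (p. 30): (i) "The '±-indeterminacy' of Theorem 1.10, (i), (iii), is reminiscent of,
but stronger than, the indeterminacy up to multiplication by a 12-th root of unity of [GalSect], Corollary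
4.12 …" (commentary); (ii) ERRATUM to [GalSect] Cor. 4.12 printed here: "the author omitted the
hypothesis that '`K` contain a primitive 12-th root of unity'". No decl.

**Remark 1.10.2** (p. 31): on strengthening Thm. 1.10 via the absolute `p`-adic Grothendieck Conjecture
of [AbsCusp] = [Mzk16] Cor. 2.3, and possible generalisations to bases such as `ℤ_p[[q]][q⁻¹] ⊗ ℚ_p` —
commentary; no decl.

**Remark 1.10.3** (pp. 31–32): (i) the étale theta function lives on the theta quotient
`Π^tp_X ↠ (Π^tp_X)^Θ`, but "the very strong rigidity property of Theorem 1.10, (i) … fails to hold if …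
one replaces `Π^tp_{C☐}` by the corresponding theta quotient `(Π^tp_{C☐})^Θ`" (informal claim about
automorphisms of `(Π^tp_X)^Θ`; not typed); (ii) topological motivation (`S^{ell∖tors}` as an
amalgam) — commentary. No decl.

**Remark 1.10.4** (p. 33): (i) Kummer-theoretic functions on points are "very special" when only the
multiplicative structure is available; (ii) for `Π` an arbitrary topological group surjecting onto `G_K`,
constructing functions from classes `κ ∈ H¹(Π, Ẑ(1))` is "highly nontrivial"; e.g. `Π = Ẑ(1) ⋊ G_K`
fails the analogue of Thm. 1.10 (i). Commentary (cited ×3 by [IUTchII]); no decl. -/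

end Thm110

end Literature.AnabelianGeometry.EtaleTheta

end
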